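import Literature.NumberTheory.IwasawaTheory.FukudaRankCountingLemmas
import Literature.NumberTheory.NumberFields.UnramifiedHomsOddNarrowClassNumber
import HarnessLib

/-!
# Narrow class-field-theoretic RANK counting lemmas: `[E : K] ∣ [Cl⁺_K : (Cl⁺_K)^p]` for abelian `E/K` killed by `p` and
# unramified at the FINITE primes, the narrow elementary `p`-class field in any `Ω ⊇ K`, `[G : G'·⟨inertia⟩·G^p] ∣ [Cl⁺_M : (Cl⁺_M)^p]`,
# and the comparisons `[Cl_K : Cl_K^p] ∣ [Cl⁺_K : (Cl⁺_K)^p]`, `(h⁺_K/h_K) ∣ [Cl⁺_K : (Cl⁺_K)²]`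

`Proofs`-style file (THEOREMS ONLY: no definition, no named fact, no `sorry`) in topic `NumberTheory/NumberFields` (namespace
`Literature.NumberTheory.NumberFields`), written by the prover seat `cruxlead-stmt-BirchSwinnertonDyer-19573-w2` GEN 9 (cell `bsd-2adic`;
`--supports` stmt-BirchSwinnertonDyer-19573; closes nothing).  First brick of «NARROW FUKUDA»: Fukuda's Theorem 1 (2) (Proc. Japan Acad. 70 A
(1994) p. 264: the `p`-ranks of the class groups in a `ℤ_p`-tower are constant as soon as two consecutive layers agree) for the NARROW class
groups `Cl⁺(K_n)`, whose proof is Fukuda's Nakayama argument VERBATIM for the maximal abelian pro-`p` extension of `K_∞` unramified at all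
FINITE primes (Greenberg, LNM 1716 p. 122: «`L*_∞` … the maximal abelian pro-2 extension of `ℚ_∞` which is unramified at all nonarchimedean
primes»).  At finite level the tree proves the wide theorem through class-field-theoretic counting lemmas over the Hilbert class field
(`FukudaRankCountingLemmas`, `FukudaPElementaryInclusion`); this file is their NARROW twin over the big Hilbert class field
`K¹ = narrowRayClassField K ⊤` (Neukirch VI (6.8): the maximal abelian extension unramified at every finite prime, of degree `h⁺_K`, Galois group
`≅ Cl⁺_K`; tree `BigHilbertClassField`, `ConductorOfAbelianExtension.le_narrowRayClassField_top_of_forall_isUnramifiedIn`,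
`narrowRayClassField_galEquivRayClassGroup`).  The condition at the infinite places disappears throughout.

## Main results (`K`, `M` number fields; `Cl⁺ = NarrowClassGroup`, `[Cl⁺ : (Cl⁺)^p] = (powMonoidHom p).range.index`)

* §0 `index_range_powMonoidHom_eq_card_ker'` (`[A : A^n] = #A[n]` for a finite abelian group) and
  `index_range_powMonoidHom_narrowClassGroup_eq_prime_pow` (`[Cl⁺ : (Cl⁺)^p]` is a power of `p`).
* §1 **`finrank_dvd_index_range_pow_narrowClassGroup_of_pow_eq_one`** — `[E : K] ∣ [Cl⁺_K : (Cl⁺_K)^p]` for `E/K` finite abelian, unramified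
  at every finite prime, `Gal(E/K)` killed by `p` (ANY behaviour at the real places); **`exists_intermediateField_pElementaryNarrow`** — the class
  field of `(Cl⁺_K)^p` realised in any algebraically closed `Ω ⊇ K` (abelian, unramified at the finite primes, exponent `p`, degree
  `[Cl⁺_K : (Cl⁺_K)^p]`).
* §2 **`index_sup_pow_dvd_index_range_pow_narrowClassGroup`** — for `E/M` finite Galois and `N ≤ G = Gal(E/M)` containing `G'` and every inertia
  group of a maximal ideal of `𝓞 E`: `[G : N·G^p] ∣ [Cl⁺_M : (Cl⁺_M)^p]` (no hypothesis at infinity).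
* §3 `index_range_pow_classGroup_dvd_narrowClassGroup` (`[Cl_K : Cl_K^p] ∣ [Cl⁺_K : (Cl⁺_K)^p]`, via the wide elementary class field) and
  **`relIndex_totPosPrincipalIdeals_dvd_index_range_pow_two`** (`[P_K : P_K⁺] = h⁺/h` divides `[Cl⁺_K : (Cl⁺_K)²]`: the kernel `P_K/P_K⁺` of
  `Cl⁺ ↠ Cl` is killed by `2`), whence `padicValNat_two_narrowClassNumber_le` (`ord₂ h⁺ ≤ ord₂ h + rank₂ Cl⁺`).

References: [Fukuda1994] Thm. 1 (2), p. 264; [Washington1997] §13.3 Lemma 13.15, Prop. 13.23; [NeukirchANT1999] Ch. VI §6 Prop. (6.8),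
§7 Thm. (7.1); [Lang1990] Ch. 13 §2; [FrohlichTaylor1990] Ch. V §1 (1.8)–(1.13); [GreenbergLNM1716] p. 122.
-/

noncomputable section

open scoped NumberField nonZeroDivisors
open NumberField IsDedekindDomain Field IntermediateField

namespace Literature.NumberTheory.NumberFields

open Literature.NumberTheory.GaloisRepresentations

/-! ## §0 Finite abelian groups: `[A : A^n] = #A[n]`, and `[Cl⁺ : (Cl⁺)^p]` is a `p`-power -/

/-- For a finite commutative group `A`, `[A : Aⁿ] = #A[n]` (`A/A[n] ≅ Aⁿ`). [folklore]
[cite: Lang1990, Ch. 13 §2 (`C(p) = C/C^p`)] -/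
theorem index_range_powMonoidHom_eq_card_ker' (A : Type*) [CommGroup A] [Finite A] (n : ℕ) :
    (powMonoidHom (α := A) n).range.index = Nat.card (powMonoidHom (α := A) n).ker := by
  have h1 : (powMonoidHom (α := A) n).ker.index = Nat.card (powMonoidHom (α := A) n).range := Subgroup.index_ker _
  have h2 : (powMonoidHom (α := A) n).ker.index * Nat.card (powMonoidHom (α := A) n).ker = Nat.card A :=
    Subgroup.index_mul_card _
  have h3 : (powMonoidHom (α := A) n).range.index * Nat.card (powMonoidHom (α := A) n).range = Nat.card A :=
    Subgroup.index_mul_card _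
  rw [h1, ← h3, mul_comm] at h2
  exact (Nat.eq_of_mul_eq_mul_right (Nat.card_pos (α := (powMonoidHom (α := A) n).range)) h2).symm

/-- For a finite commutative group `A` and a prime `p`, `[A : A^p]` is a power of `p` (`A/A^p` is killed by `p`). [folklore]
[cite: Lang1990, Ch. 13 §2 (`C(p) = C/C^p`, an `𝔽_p`-space)] -/
theorem exists_index_range_powMonoidHom_eq_prime_pow' (A : Type*) [CommGroup A] [Finite A] (p : ℕ) [hp : Fact p.Prime] :
    ∃ c : ℕ, (powMonoidHom (α := A) p).range.index = p ^ c := by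
  have hP : IsPGroup p (A ⧸ (powMonoidHom (α := A) p).range) := by
    intro q
    obtain ⟨c, rfl⟩ := QuotientGroup.mk_surjective q
    refine ⟨1, ?_⟩
    rw [pow_one, ← QuotientGroup.mk_pow, QuotientGroup.eq_one_iff]
    exact ⟨c, rfl⟩
  obtain ⟨c, hc⟩ := IsPGroup.iff_card.mp hP
  exact ⟨c, by rw [Subgroup.index_eq_card, hc]⟩

variable {K : Type} [Field K] [NumberField K]

/-- **`[Cl⁺_K : (Cl⁺_K)^p]` is a power of `p`.** [cite: Lang1990, Ch. 13 §2] [cite: FrohlichTaylor1990, Ch. V §1, p. 163] -/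
theorem index_range_powMonoidHom_narrowClassGroup_eq_prime_pow (p : ℕ) [Fact p.Prime] :
    ∃ c : ℕ, (powMonoidHom (α := NarrowClassGroup K) p).range.index = p ^ c :=
  haveI : Finite (NarrowClassGroup K) := finite_rayClassGroup top_ne_bot
  exists_index_range_powMonoidHom_eq_prime_pow' _ p

/-! ## §1 Abelian extensions killed by `p`, unramified at the finite primes, and the narrow elementary `p`-class field -/

/-- **`[E : K] ∣ [Cl⁺_K : (Cl⁺_K)^p]`** for a finite ABELIAN extension `E/K`, unramified at every FINITE prime (any behaviour at the real
places), whose Galois group is killed by `p`: a copy of `E` in `K̄` lies in the big Hilbert class field `K¹` (Neukirch VI (6.8)); the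
restriction `Gal(K¹/K) ↠ Gal(E/K)` kills the `p`-th powers, and `Gal(K¹/K) ≅ Cl⁺_K` (Artin). [cite: NeukirchANT1999, Ch. VI §6 Prop. (6.8) and §7 Thm. (7.1)]
[cite: Lang1990, Ch. 13 §2, Thm. 2.1 (proof: «`G ≈ C(p)`»)] -/
theorem finrank_dvd_index_range_pow_narrowClassGroup_of_pow_eq_one (E : Type*) [Field E] [NumberField E]
    [Algebra K E] [IsAbelianGalois K E]
    (hunr : ∀ v : HeightOneSpectrum (𝓞 K), Algebra.IsUnramifiedIn (𝓞 E) v.asIdeal) (p : ℕ)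
    (hexp : ∀ σ : E ≃ₐ[K] E, σ ^ p = 1) :
    Module.finrank K E ∣ (powMonoidHom (α := NarrowClassGroup K) p).range.index := by
  classical
  haveI : Algebra.IsAlgebraic K E := Algebra.IsAlgebraic.of_finite K E
  let ι : E →ₐ[K] AlgebraicClosure K := IsAlgClosed.lift
  let E' : IntermediateField K (AlgebraicClosure K) := ι.fieldRange
  let e : E ≃ₐ[K] E' := AlgEquiv.ofInjectiveField ι
  haveI : FiniteDimensional K E' := LinearEquiv.finiteDimensional e.toLinearEquiv
  haveI : IsAbelianGalois K E' := IsAbelianGalois.of_algHom e.symm.toAlgHom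
  haveI : NumberField E' := NumberField.of_module_finite K E'
  have hunr' := forall_isUnramifiedIn_of_algHom e.symm.toAlgHom hunr
  have hle : E' ≤ narrowRayClassField K (top_ne_bot : (⊤ : Ideal (𝓞 K)) ≠ ⊥) :=
    le_narrowRayClassField_top_of_forall_isUnramifiedIn E' hunr'
  -- `E'` as an intermediate field `E₀` of `K¹/K`; the restriction `ρ : Gal(K¹/K) ↠ Gal(E₀/K)`
  let E₀ : IntermediateField K (narrowRayClassField K (top_ne_bot : (⊤ : Ideal (𝓞 K)) ≠ ⊥)) :=
    IntermediateField.restrict hle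
  let e₀ : E' ≃ₐ[K] E₀ := IntermediateField.restrict_algEquiv hle
  haveI : IsGalois K E₀ := IsGalois.of_algEquiv e₀
  obtain ⟨ρ, hρ⟩ : ∃ ρ : ((narrowRayClassField K (top_ne_bot : (⊤ : Ideal (𝓞 K)) ≠ ⊥)) ≃ₐ[K]
      (narrowRayClassField K (top_ne_bot : (⊤ : Ideal (𝓞 K)) ≠ ⊥))) →* (E₀ ≃ₐ[K] E₀), ρ = AlgEquiv.restrictNormalHom E₀ :=
    ⟨_, rfl⟩
  have hsurj : Function.Surjective ρ := by
    rw [hρ]; exact AlgEquiv.restrictNormalHom_surjective _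
  have hdeg : Module.finrank K E = ρ.ker.index := by
    rw [Subgroup.index_ker, MonoidHom.range_eq_top.mpr hsurj, Subgroup.card_top, IsGalois.card_aut_eq_finrank,
      e.toLinearEquiv.finrank_eq, e₀.toLinearEquiv.finrank_eq]
  -- the `p`-th powers die in `Gal(E₀/K)`
  have hexp₀ : ∀ τ : E₀ ≃ₐ[K] E₀, τ ^ p = 1 := fun τ => by
    obtain ⟨τ', rfl⟩ := (AlgEquiv.autCongr (e.trans e₀)).surjective τ
    rw [← map_pow, hexp, map_one]
  have hpow : ∀ σ : (narrowRayClassField K (top_ne_bot : (⊤ : Ideal (𝓞 K)) ≠ ⊥)) ≃ₐ[K]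
      (narrowRayClassField K (top_ne_bot : (⊤ : Ideal (𝓞 K)) ≠ ⊥)), σ ^ p ∈ ρ.ker := fun σ => by
    rw [MonoidHom.mem_ker, map_pow, hexp₀]
  -- transfer to `Cl⁺_K` along Artin reciprocity `Gal(K¹/K) ≅ Cl⁺_K`
  have hle' : (powMonoidHom (α := NarrowClassGroup K) p).range ≤
      ρ.ker.map ((narrowRayClassField_galEquivRayClassGroup (K := K) (top_ne_bot : (⊤ : Ideal (𝓞 K)) ≠ ⊥) :
        ((narrowRayClassField K (top_ne_bot : (⊤ : Ideal (𝓞 K)) ≠ ⊥)) ≃ₐ[K]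
          (narrowRayClassField K (top_ne_bot : (⊤ : Ideal (𝓞 K)) ≠ ⊥))) ≃* NarrowClassGroup K) :
        ((narrowRayClassField K (top_ne_bot : (⊤ : Ideal (𝓞 K)) ≠ ⊥)) ≃ₐ[K]
          (narrowRayClassField K (top_ne_bot : (⊤ : Ideal (𝓞 K)) ≠ ⊥))) →* NarrowClassGroup K) := by
    rintro _ ⟨c, rfl⟩
    obtain ⟨σ, rfl⟩ :=
      (narrowRayClassField_galEquivRayClassGroup (K := K) (top_ne_bot : (⊤ : Ideal (𝓞 K)) ≠ ⊥)).surjective c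
    refine ⟨σ ^ p, hpow σ, ?_⟩
    rw [MonoidHom.coe_coe, map_pow, powMonoidHom_apply]
  rw [hdeg, ← Subgroup.index_map_equiv (H := ρ.ker)
    (e := narrowRayClassField_galEquivRayClassGroup (K := K) (top_ne_bot : (⊤ : Ideal (𝓞 K)) ≠ ⊥))]
  exact Subgroup.index_dvd_of_le hle'

/-- **The narrow elementary `p`-class field realised inside any algebraically closed field over `K`.** For a number field `K`, a natural
number `p` and an algebraically closed `Ω ⊇ K` (algebraic over `K`), there is an intermediate field `P/K` of `Ω`, finite ABELIAN over `K`,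
UNRAMIFIED at every finite prime, with `Gal(P/K)` killed by `p` and `[P : K] = [Cl⁺_K : (Cl⁺_K)^p]`: the fixed field in the big Hilbert class
field `K¹` of the `p`-th powers of `Gal(K¹/K) ≅ Cl⁺_K`, transported along a `K`-embedding `K̄ → Ω`. [cite: NeukirchANT1999, Ch. VI §6 Prop. (6.8) and §7 Thm. (7.1)]
[cite: Lang1990, Ch. 13 §2, Thm. 2.1 (proof: «`G ≈ C(p)`»)] -/
theorem exists_intermediateField_pElementaryNarrow (K : Type) [Field K] [NumberField K] (p : ℕ)
    (Ω' : Type*) [Field Ω'] [Algebra K Ω'] [IsAlgClosed Ω'] [Algebra.IsAlgebraic K Ω'] :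
    ∃ (P : IntermediateField K Ω') (_ : FiniteDimensional K P),
      IsAbelianGalois K P ∧
        (∀ v : HeightOneSpectrum (𝓞 K), Algebra.IsUnramifiedIn (𝓞 P) v.asIdeal) ∧
          (∀ σ : P ≃ₐ[K] P, σ ^ p = 1) ∧
            Module.finrank K P = (powMonoidHom (α := NarrowClassGroup K) p).range.index := by
  classical
  -- the subgroup of `p`-th powers of `Gal(K¹/K)` and its fixed field `P₀`
  obtain ⟨N, hN⟩ : ∃ N : Subgroup ((narrowRayClassField K (top_ne_bot : (⊤ : Ideal (𝓞 K)) ≠ ⊥)) ≃ₐ[K]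
      (narrowRayClassField K (top_ne_bot : (⊤ : Ideal (𝓞 K)) ≠ ⊥))),
      N = Subgroup.closure (Set.range fun σ : (narrowRayClassField K (top_ne_bot : (⊤ : Ideal (𝓞 K)) ≠ ⊥)) ≃ₐ[K]
        (narrowRayClassField K (top_ne_bot : (⊤ : Ideal (𝓞 K)) ≠ ⊥)) => σ ^ p) := ⟨_, rfl⟩
  haveI hNn : N.Normal := inferInstance
  set P₀ : IntermediateField K (narrowRayClassField K (top_ne_bot : (⊤ : Ideal (𝓞 K)) ≠ ⊥)) :=
    IntermediateField.fixedField N with hP₀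
  haveI : IsGalois K P₀ := IsGalois.of_fixedField_normal_subgroup N
  haveI : NumberField P₀ := NumberField.of_module_finite K P₀
  have hP₀deg : Module.finrank K P₀ = N.index := by
    have h1 := Module.finrank_mul_finrank K P₀ (narrowRayClassField K (top_ne_bot : (⊤ : Ideal (𝓞 K)) ≠ ⊥))
    rw [hP₀, IntermediateField.finrank_fixedField_eq_card N] at h1
    have h2 : N.index * Nat.card N = Nat.card ((narrowRayClassField K (top_ne_bot : (⊤ : Ideal (𝓞 K)) ≠ ⊥)) ≃ₐ[K]
        (narrowRayClassField K (top_ne_bot : (⊤ : Ideal (𝓞 K)) ≠ ⊥))) := N.index_mul_card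
    rw [IsGalois.card_aut_eq_finrank] at h2
    rw [hP₀]
    exact Nat.eq_of_mul_eq_mul_right Nat.card_pos (h1.trans h2.symm)
  -- `[Cl⁺ : (Cl⁺)^p] = [Gal(K¹/K) : N]`
  have hNindex : N.index = (powMonoidHom (α := NarrowClassGroup K) p).range.index := by
    rw [← Subgroup.index_map_equiv (H := N)
      (e := narrowRayClassField_galEquivRayClassGroup (K := K) (top_ne_bot : (⊤ : Ideal (𝓞 K)) ≠ ⊥))]
    congr 1
    rw [hN, MonoidHom.map_closure]
    apply le_antisymm
    · rw [Subgroup.closure_le]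
      rintro _ ⟨_, ⟨σ, rfl⟩, rfl⟩
      refine ⟨narrowRayClassField_galEquivRayClassGroup (K := K) (top_ne_bot : (⊤ : Ideal (𝓞 K)) ≠ ⊥) σ, ?_⟩
      rw [MonoidHom.coe_coe, map_pow, powMonoidHom_apply]
    · rintro _ ⟨c, rfl⟩
      obtain ⟨σ, rfl⟩ :=
        (narrowRayClassField_galEquivRayClassGroup (K := K) (top_ne_bot : (⊤ : Ideal (𝓞 K)) ≠ ⊥)).surjective c
      refine Subgroup.subset_closure ⟨σ ^ p, ⟨σ, rfl⟩, ?_⟩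
      rw [MonoidHom.coe_coe, map_pow, powMonoidHom_apply]
  have hP₀exp : ∀ τ : P₀ ≃ₐ[K] P₀, τ ^ p = 1 := by
    intro τ
    obtain ⟨σ, rfl⟩ := AlgEquiv.restrictNormalHom_surjective
      (narrowRayClassField K (top_ne_bot : (⊤ : Ideal (𝓞 K)) ≠ ⊥)) τ
    rw [← map_pow, ← MonoidHom.mem_ker, IntermediateField.restrictNormalHom_ker P₀, hP₀,
      IntermediateField.fixingSubgroup_fixedField, hN]
    exact Subgroup.subset_closure ⟨σ, rfl⟩
  have hP₀unr : ∀ v : HeightOneSpectrum (𝓞 K), Algebra.IsUnramifiedIn (𝓞 P₀) v.asIdeal :=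
    forall_isUnramifiedIn_of_algHom
      (IsScalarTower.toAlgHom K P₀ (narrowRayClassField K (top_ne_bot : (⊤ : Ideal (𝓞 K)) ≠ ⊥)))
      (fun v => isUnramifiedIn_narrowRayClassField (K := K) (top_ne_bot : (⊤ : Ideal (𝓞 K)) ≠ ⊥)
        (fun h => v.isPrime.ne_top (top_le_iff.mp h)))
  -- transport along `K¹ → K̄ → Ω'`
  let ψ : AlgebraicClosure K →ₐ[K] Ω' := IsAlgClosed.lift
  set P : IntermediateField K Ω' := (IntermediateField.lift P₀).map ψ with hP
  let e : P₀ ≃ₐ[K] P := (IntermediateField.liftAlgEquiv P₀).trans (IntermediateField.equivMap (IntermediateField.lift P₀) ψ)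
  haveI hPfd : FiniteDimensional K P := LinearEquiv.finiteDimensional e.toLinearEquiv
  haveI : NumberField P := NumberField.of_module_finite K P
  haveI : IsAbelianGalois K P₀ :=
    IsAbelianGalois.of_algHom (IsScalarTower.toAlgHom K P₀ (narrowRayClassField K (top_ne_bot : (⊤ : Ideal (𝓞 K)) ≠ ⊥)))
  refine ⟨P, hPfd, IsAbelianGalois.of_algHom (e.symm : P →ₐ[K] P₀),
    forall_isUnramifiedIn_of_algHom (e.symm : P →ₐ[K] P₀) hP₀unr, ?_, ?_⟩
  · intro σ
    obtain ⟨τ, rfl⟩ := (AlgEquiv.autCongr e).surjective σ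
    rw [← map_pow, hP₀exp, map_one]
  · rw [← e.toLinearEquiv.finrank_eq, hP₀deg, hNindex]

/-! ## §2 `[G : G'·⟨inertia⟩·G^p] ∣ [Cl⁺_M : (Cl⁺_M)^p]` for a finite Galois extension (no condition at infinity) -/

/-- A subgroup containing the commutator subgroup is normal. [folklore] -/
private theorem normal_of_commutator_le₉ {G : Type*} [Group G] {N : Subgroup G} (h : ⁅(⊤ : Subgroup G), ⊤⁆ ≤ N) :
    N.Normal :=
  ⟨fun m hm g => by
    have h2 := Subgroup.commutator_mem_commutator (Subgroup.mem_top g) (Subgroup.mem_top m)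
    rw [commutatorElement_def] at h2
    have h1 : g * m * g⁻¹ = g * m * g⁻¹ * m⁻¹ * m := by group
    rw [h1]
    exact mul_mem (h h2) hm⟩

/-- **`[G : N·G^p] ∣ [Cl⁺_M : (Cl⁺_M)^p]`.** Let `E/M` be a finite Galois extension of number fields, `G = Gal(E/M)`, and `N ≤ G` a subgroup
containing the commutator subgroup and the inertia group of every maximal ideal of `𝓞 E`. Then `N' = N·⟨σ^p : σ ∈ G⟩` has
`[G : N'] ∣ [Cl⁺_M : (Cl⁺_M)^p]`: its fixed field is abelian over `M`, unramified at every finite prime (Serre I §7 Prop. 22), with Galois group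
`G/N'` killed by `p` (§1).  The narrow twin of `index_sup_pow_dvd_index_range_pow` (no hypothesis at the infinite places).
[cite: Washington1997, §13.3 Lemma 13.15 and Prop. 13.23 (proof)] [cite: NeukirchANT1999, Ch. VI §6 Prop. (6.8)] -/
theorem index_sup_pow_dvd_index_range_pow_narrowClassGroup (M E : Type) [Field M] [NumberField M] [Field E]
    [NumberField E] [Algebra M E] [IsGalois M E] (N : Subgroup (E ≃ₐ[M] E))
    (hcomm : ⁅(⊤ : Subgroup (E ≃ₐ[M] E)), ⊤⁆ ≤ N)
    (hIN : ∀ (Q : Ideal (𝓞 E)) [Q.IsMaximal], Q.inertia (E ≃ₐ[M] E) ≤ N) (p : ℕ) :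
    (N ⊔ Subgroup.closure (Set.range fun σ : E ≃ₐ[M] E => σ ^ p)).index ∣
      (powMonoidHom (α := NarrowClassGroup M) p).range.index := by
  classical
  set N' : Subgroup (E ≃ₐ[M] E) := N ⊔ Subgroup.closure (Set.range fun σ : E ≃ₐ[M] E => σ ^ p) with hN'
  have hcomm' : ⁅(⊤ : Subgroup (E ≃ₐ[M] E)), ⊤⁆ ≤ N' := hcomm.trans le_sup_left
  haveI : N'.Normal := normal_of_commutator_le₉ hcomm'
  set F : IntermediateField M E := IntermediateField.fixedField N' with hF
  haveI : IsGalois M F := IsGalois.of_fixedField_normal_subgroup N'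
  have hFdeg : Module.finrank M F = N'.index := by
    have h1 := Module.finrank_mul_finrank M F E
    rw [hF, IntermediateField.finrank_fixedField_eq_card N'] at h1
    have h2 : N'.index * Nat.card N' = Nat.card (E ≃ₐ[M] E) := N'.index_mul_card
    rw [IsGalois.card_aut_eq_finrank] at h2
    rw [hF]
    exact Nat.eq_of_mul_eq_mul_right Nat.card_pos (h1.trans h2.symm)
  -- `Gal(F/M) ≅ G/N'` is commutative and killed by `p`
  haveI : IsAbelianGalois M F := by
    refine { is_comm := ⟨fun x y => ?_⟩ }
    obtain ⟨x', rfl⟩ := (IsGalois.normalAutEquivQuotient N').surjective x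
    obtain ⟨y', rfl⟩ := (IsGalois.normalAutEquivQuotient N').surjective y
    rw [← map_mul, ← map_mul]
    congr 1
    have hc : IsMulCommutative ((E ≃ₐ[M] E) ⧸ N') := by
      rw [Subgroup.Normal.quotient_commutative_iff_commutator_le, commutator_def]
      exact hcomm'
    exact hc.is_comm.comm x' y'
  have hexp : ∀ x : F ≃ₐ[M] F, x ^ p = 1 := by
    intro x
    obtain ⟨x', rfl⟩ := (IsGalois.normalAutEquivQuotient N').surjective x
    obtain ⟨σ, rfl⟩ := QuotientGroup.mk_surjective x'
    rw [← map_pow, ← QuotientGroup.mk_pow, (QuotientGroup.eq_one_iff _).mpr, map_one]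
    exact Subgroup.mem_sup_right (Subgroup.subset_closure ⟨σ, rfl⟩)
  have hunrF : ∀ v : HeightOneSpectrum (𝓞 M), Algebra.IsUnramifiedIn (𝓞 F) v.asIdeal := by
    intro v q hq hqv
    haveI := hq
    have hq0 : q ≠ ⊥ := by
      intro h0
      apply v.ne_bot
      rw [hqv.over, h0, Ideal.under_def, Ideal.comap_bot_of_injective _
        (FaithfulSMul.algebraMap_injective (𝓞 M) (𝓞 F))]
    haveI : q.IsMaximal := hq.isMaximal hq0
    obtain ⟨Q, hQmax, hQq⟩ := Ideal.exists_maximal_ideal_liesOver_of_isIntegral (S := 𝓞 E) q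
    haveI := hQmax
    have hq' : q = Q.under (𝓞 F) := hQq.over
    subst hq'
    rw [isUnramifiedAt_under_iff_inertia_le' F Q, hF, IntermediateField.fixingSubgroup_fixedField]
    exact (hIN Q).trans le_sup_left
  haveI : NumberField F := NumberField.of_module_finite M F
  have hdvd := finrank_dvd_index_range_pow_narrowClassGroup_of_pow_eq_one (K := M) F hunrF p hexp
  rwa [hFdeg] at hdvd

/-! ## §3 Comparisons: `[Cl : Cl^p] ∣ [Cl⁺ : (Cl⁺)^p]` and `h⁺/h ∣ [Cl⁺ : (Cl⁺)²]` -/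

/-- **`[Cl_K : Cl_K^p] ∣ [Cl⁺_K : (Cl⁺_K)^p]`** (`rank_p Cl_K ≤ rank_p Cl⁺_K`): the elementary `p`-class field of `K` (abelian, unramified at
all places, exponent `p`, degree `[Cl_K : Cl_K^p]`, tree `exists_intermediateField_pElementary`) is in particular unramified at the finite primes,
so §1 applies.  (Equivalently: `Cl⁺ ↠ Cl` induces `Cl⁺/(Cl⁺)^p ↠ Cl/Cl^p`.) [cite: FrohlichTaylor1990, Ch. V §1 (1.8) (π_N surjective), p. 163]
[cite: NeukirchANT1999, Ch. VI §6 Prop. (6.8)–(6.9)] -/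
theorem index_range_pow_classGroup_dvd_narrowClassGroup (p : ℕ) :
    (powMonoidHom p : ClassGroup (𝓞 K) →* ClassGroup (𝓞 K)).range.index ∣
      (powMonoidHom (α := NarrowClassGroup K) p).range.index := by
  obtain ⟨P, hPfd, hPab, -, hPunr, hPexp, hPdeg⟩ := exists_intermediateField_pElementary K p (AlgebraicClosure K)
  haveI := hPfd
  haveI := hPab
  haveI : NumberField P := NumberField.of_module_finite K P
  rw [← hPdeg]
  exact finrank_dvd_index_range_pow_narrowClassGroup_of_pow_eq_one P hPunr p hPexp

omit [NumberField K] in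
/-- In `Multiplicative ((K →+* ℝ) → ZMod 2)` every element has square `1`. [folklore] -/
private theorem sq_eq_one_signatures (g : Multiplicative ((K →+* ℝ) → ZMod 2)) : g ^ 2 = 1 := by
  rw [← ofAdd_toAdd g, ← ofAdd_nsmul, two_nsmul]
  have : Multiplicative.toAdd g + Multiplicative.toAdd g = 0 := by
    funext σ
    rw [Pi.add_apply, Pi.zero_apply]
    generalize Multiplicative.toAdd g σ = a
    fin_cases a <;> decide
  rw [this, ofAdd_zero]

/-- **`[P_K : P_K⁺] ∣ [Cl⁺_K : (Cl⁺_K)²]`** — the kernel `P_K/P_K⁺` of `Cl⁺_K ↠ Cl_K` (of order `h⁺/h`, Fröhlich–Taylor (1.8)–(1.9)) is killed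
by `2` (`(a)² = (a²)` with `a²` totally positive), hence lies in `Cl⁺_K[2]`, whose order is `[Cl⁺_K : (Cl⁺_K)²]`.
[cite: FrohlichTaylor1990, Ch. V §1 (1.8)–(1.13), pp. 163–164] [cite: NeukirchANT1999, Ch. VI §1 Def. (1.7)] -/
theorem relIndex_totPosPrincipalIdeals_dvd_index_range_pow_two :
    (totPosPrincipalIdeals K).relIndex (toPrincipalIdeal (𝓞 K) K).range ∣
      (powMonoidHom (α := NarrowClassGroup K) 2).range.index := by
  classical
  haveI : Finite (NarrowClassGroup K) := finite_rayClassGroup top_ne_bot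
  -- the image `V` of the principal ideals in `Cl⁺ = J/P⁺`
  set T : Subgroup (FractionalIdeal (𝓞 K)⁰ K)ˣ := idealsPrimeTo (⊤ : Ideal (𝓞 K)) with hT
  set R : Subgroup T := (ray (⊤ : Ideal (𝓞 K))).subgroupOf T with hR
  set π : T →* NarrowClassGroup K := QuotientGroup.mk' R with hπ
  have hπsurj : Function.Surjective π := QuotientGroup.mk'_surjective R
  set V : Subgroup (NarrowClassGroup K) := ((toPrincipalIdeal (𝓞 K) K).range.subgroupOf T).map π with hV
  -- `V` is killed by `2`
  have hVker : V ≤ (powMonoidHom (α := NarrowClassGroup K) 2).ker := by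
    rintro _ ⟨I, hI, rfl⟩
    obtain ⟨x, hx⟩ := Subgroup.mem_subgroupOf.mp hI
    rw [MonoidHom.mem_ker, powMonoidHom_apply, ← map_pow, hπ, QuotientGroup.mk'_apply, QuotientGroup.eq_one_iff, hR,
      Subgroup.mem_subgroupOf, ray_top, Subgroup.coe_pow]
    refine ⟨x ^ 2, ?_, by rw [map_pow, hx]⟩
    rw [SetLike.mem_coe, MonoidHom.mem_ker, map_pow]
    exact sq_eq_one_signatures _
  -- `#V = [P : P⁺]`
  have hVindex : V.index = classNumber K := by
    rw [hV, Subgroup.index_map, hπ, QuotientGroup.ker_mk', MonoidHom.range_eq_top.mpr hπsurj, Subgroup.index_top, mul_one,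
      sup_eq_left.mpr, ← Subgroup.relIndex, hT, idealsPrimeTo_top, Subgroup.relIndex_top_right, classNumber_eq_index]
    rw [hR, ray_top]
    intro x hx
    exact Subgroup.mem_subgroupOf.mpr (totPosPrincipalIdeals_le_range K (Subgroup.mem_subgroupOf.mp hx))
  have hVcard : Nat.card V = (totPosPrincipalIdeals K).relIndex (toPrincipalIdeal (𝓞 K) K).range := by
    have h1 : V.index * Nat.card V = Nat.card (NarrowClassGroup K) := V.index_mul_card
    rw [hVindex] at h1
    change _ = narrowClassNumber K at h1
    rw [narrowClassNumber_eq_classNumber_mul_relIndex] at h1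
    exact Nat.eq_of_mul_eq_mul_left (classNumber_pos K) h1
  rw [← hVcard, index_range_powMonoidHom_eq_card_ker']
  exact Subgroup.card_dvd_of_le hVker

/-- **`ord₂ h⁺_K ≤ ord₂ h_K + rank₂ Cl⁺_K`** (`rank₂ Cl⁺_K = ord₂ [Cl⁺_K : (Cl⁺_K)²]`): the narrow defect `ord₂ h⁺ − ord₂ h = ord₂ [P_K : P_K⁺]` is at
most the `2`-rank of the narrow class group. [cite: FrohlichTaylor1990, Ch. V §1 (1.8)–(1.13), pp. 163–164] -/
theorem padicValNat_two_narrowClassNumber_le :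
    padicValNat 2 (narrowClassNumber K) ≤ padicValNat 2 (classNumber K) +
      padicValNat 2 ((powMonoidHom (α := NarrowClassGroup K) 2).range.index) := by
  haveI : Fact (Nat.Prime 2) := ⟨Nat.prime_two⟩
  haveI : Finite (NarrowClassGroup K) := finite_rayClassGroup top_ne_bot
  have hrel0 : (totPosPrincipalIdeals K).relIndex (toPrincipalIdeal (𝓞 K) K).range ≠ 0 := by
    intro h0
    have h := narrowClassNumber_eq_classNumber_mul_relIndex K
    rw [h0, mul_zero] at h
    exact (Nat.card_pos (α := NarrowClassGroup K)).ne' h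
  have hidx0 : (powMonoidHom (α := NarrowClassGroup K) 2).range.index ≠ 0 := Subgroup.index_ne_zero_of_finite
  rw [narrowClassNumber_eq_classNumber_mul_relIndex, padicValNat.mul (classNumber_pos K).ne' hrel0]
  refine Nat.add_le_add_left ?_ _
  have hdvd := relIndex_totPosPrincipalIdeals_dvd_index_range_pow_two (K := K)
  exact (padicValNat_dvd_iff_le hidx0).mp (pow_padicValNat_dvd.trans hdvd)

end Literature.NumberTheory.NumberFields

end
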